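import Literature.Geometry.GeometricMeasureTheory.ApproxTangentChart
import Literature.Geometry.GeometricMeasureTheory.RectifiableNormalize

/-!
# Tangent cones of bi-Lipschitz images of measurable pieces (towards `f_# 𝓡_m ⊆ 𝓡_m`)

First brick of the proof that the push-forward of a rectifiable current along a smooth map is a
rectifiable current (Federer 4.1.30, via the area formula): the structure of the image `F(E)` of
a measurable piece `E ⊆ P` (`P` a finite-dimensional real inner product space, `dim P = m`) under
a map `F : P → V` which is differentiable relative to `E` with injective differentials and is
anti-Lipschitz on `E` — the pieces produced by Mathlib's
`exists_partition_approximatesLinearOn_of_hasFDerivWithinAt`.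

* `posTangentConeAt_image_subset_range` — **every tangent direction of `F(E)` at `F u` lies in
  `im DF(u)`** (`u ∈ E`): a sequence `F uₙ → F u` in `F(E)` has `uₙ → u` (anti-Lipschitz), and
  `cₙ (F uₙ − F u) = DF(u)(cₙ (uₙ − u)) + o(1)`;
* `approxTangentCone_image_subset_range` — hence Federer's cone of approximate tangent vectors
  `Tan^m(𝓗^m ⌞ F(E), F u) ⊆ im DF(u)` at every `u ∈ E` [Federer1969, 3.2.16, 3.2.19];
* `ae_approxTangentCone_image_eq_range` — **`Tan^m(𝓗^m ⌞ F(E), F u) = im DF(u)` for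
  `𝓗^m`-a.e. point `F u` of `F(E)`** (`E ⊆ ℝᵐ = EuclideanSpace ℝ (Fin m)`, `F` also Lipschitz on
  `E`): extend `F|_E` to a Lipschitz map `g` of `ℝᵐ` (`LipschitzOnWith.extend_finite_dimension`);
  off an `𝓗^m`-null set of values, `g` is differentiable with injective differential at the
  preimage (Rademacher; Sard's lemma for Lipschitz maps,
  `Literature.Analysis.Calculus.hausdorffMeasure_image_null_of_fderiv_not_injective`) and
  `im Dg(u) ⊆ Tan^m` (`fderiv_apply_mem_posTangentConeAt_ae`, Federer 3.2.19); squeezed between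
  two `m`-planes, `Tan^m = im DF(u)`.

Theorems only; no named facts.

## References

* H. Federer, *Geometric Measure Theory*, Springer 1969, 3.2.16, 3.2.19, 4.1.30 [Federer1969].
-/

noncomputable section

open MeasureTheory MeasureTheory.Measure Set Function Filter Metric Module Topology
open scoped ENNReal NNReal Topology

namespace Literature.Geometry.GeometricMeasureTheory

variable {P : Type*} [NormedAddCommGroup P] [NormedSpace ℝ P] [FiniteDimensional ℝ P]
  {V : Type*} [NormedAddCommGroup V] [NormedSpace ℝ V]

/-- **Tangent directions of an anti-Lipschitz image lie in the image of the differential.** Let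
`E ⊆ P`, `u ∈ E`, `F : P → V` with `HasFDerivWithinAt F F' E u`, and suppose `F|_E` is
anti-Lipschitz. Then `Tan(F(E), F u) ⊆ im F'`: if `dₙ → 0` with `F u + dₙ = F uₙ ∈ F(E)` and
`cₙ dₙ → y`, then `uₙ → u` (anti-Lipschitz), `cₙ ‖uₙ − u‖` stays bounded, and
`cₙ dₙ − F'(cₙ (uₙ − u)) = cₙ o(‖uₙ − u‖) → 0`, so `y` lies in the closed subspace `im F'`.
[cite: Federer1969, 3.2.16] -/
theorem posTangentConeAt_image_subset_range {F : P → V} {F' : P →L[ℝ] V} {E : Set P} {u : P}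
    (hu : u ∈ E) (hF : HasFDerivWithinAt F F' E u) {K : ℝ≥0}
    (hanti : AntilipschitzWith K (E.restrict F)) :
    posTangentConeAt (F '' E) (F u) ⊆ (range F' : Set V) := by
  intro y hy
  rw [posTangentConeAt, mem_tangentConeAt_iff_exists_seq] at hy
  obtain ⟨c, d, hd0, hds, hcd⟩ := hy
  have hcd' : Tendsto (fun n => (c n : ℝ) • d n) atTop (𝓝 y) := by
    simpa [NNReal.smul_def] using hcd
  -- preimages `uₙ ∈ E` of the points `F u + dₙ` (arbitrary before they enter `F(E)`)
  classical
  have hchoice : ∀ n, ∃ v : P, (F u + d n ∈ F '' E → v ∈ E ∧ F v = F u + d n) := by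
    intro n
    by_cases h : F u + d n ∈ F '' E
    · obtain ⟨v, hv, hvF⟩ := h
      exact ⟨v, fun _ => ⟨hv, hvF⟩⟩
    · exact ⟨u, fun h' => absurd h' h⟩
  choose us hus using hchoice
  have hev : ∀ᶠ n in atTop, us n ∈ E ∧ F (us n) = F u + d n := by
    filter_upwards [hds] with n hn using hus n hn
  -- `uₙ → u` by the anti-Lipschitz property
  have hdist : ∀ᶠ n in atTop, ‖us n - u‖ ≤ K * ‖d n‖ := by
    filter_upwards [hev] with n hn
    have h := hanti.le_mul_dist ⟨us n, hn.1⟩ ⟨u, hu⟩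
    rw [Subtype.dist_eq, dist_eq_norm, dist_eq_norm] at h
    change ‖us n - u‖ ≤ K * ‖F (us n) - F u‖ at h
    rwa [hn.2, add_sub_cancel_left] at h
  have hus0 : Tendsto (fun n => us n - u) atTop (𝓝 0) := by
    rw [tendsto_zero_iff_norm_tendsto_zero]
    have h1 : Tendsto (fun n => (K : ℝ) * ‖d n‖) atTop (𝓝 0) := by
      simpa using (tendsto_const_nhds (x := (K : ℝ))).mul (tendsto_zero_iff_norm_tendsto_zero.1 hd0)
    exact squeeze_zero' (Eventually.of_forall fun n => norm_nonneg _) hdist h1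
  have husu : Tendsto us atTop (𝓝 u) := by
    have := hus0.add (tendsto_const_nhds (x := u))
    simpa using this
  have husE : Tendsto us atTop (𝓝[E] u) :=
    tendsto_nhdsWithin_iff.2 ⟨husu, hev.mono fun n hn => hn.1⟩
  -- the little-o estimate along `uₙ`
  have hsmall : ∀ ε > 0, ∀ᶠ n in atTop,
      ‖(c n : ℝ) • d n - F' ((c n : ℝ) • (us n - u))‖ ≤ ε * (K * ‖(c n : ℝ) • d n‖) := by
    intro ε hε
    filter_upwards [husE.eventually (hF.isLittleO.def hε), hev, hdist] with n hn hn' hnd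
    have h1 : ‖F (us n) - F u - F' (us n - u)‖ ≤ ε * ‖us n - u‖ := hn
    rw [hn'.2, add_sub_cancel_left] at h1
    calc ‖(c n : ℝ) • d n - F' ((c n : ℝ) • (us n - u))‖
        = (c n : ℝ) * ‖d n - F' (us n - u)‖ := by
          rw [map_smul, ← smul_sub, norm_smul, Real.norm_of_nonneg (c n).coe_nonneg]
      _ ≤ (c n : ℝ) * (ε * ‖us n - u‖) := by gcongr
      _ ≤ (c n : ℝ) * (ε * (K * ‖d n‖)) := by gcongr
      _ = ε * (K * ‖(c n : ℝ) • d n‖) := by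
          rw [norm_smul, Real.norm_of_nonneg (c n).coe_nonneg]; ring
  -- hence `F'(cₙ (uₙ - u)) → y`
  have hlim : Tendsto (fun n => F' ((c n : ℝ) • (us n - u))) atTop (𝓝 y) := by
    have hbdd : ∀ᶠ n in atTop, ‖(c n : ℝ) • d n‖ ≤ ‖y‖ + 1 :=
      hcd'.norm.eventually (Iic_mem_nhds (lt_add_one _))
    have herr : Tendsto (fun n => (c n : ℝ) • d n - F' ((c n : ℝ) • (us n - u))) atTop (𝓝 0) := by
      rw [tendsto_zero_iff_norm_tendsto_zero]
      refine Metric.tendsto_nhds.2 fun ε hε => ?_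
      have hε' : 0 < ε / (2 * ((K : ℝ) * (‖y‖ + 1) + 1)) := div_pos hε (by positivity)
      filter_upwards [hsmall _ hε', hbdd] with n hn hnb
      rw [Real.dist_0_eq_abs, abs_of_nonneg (norm_nonneg _)]
      calc ‖(c n : ℝ) • d n - F' ((c n : ℝ) • (us n - u))‖
          ≤ ε / (2 * ((K : ℝ) * (‖y‖ + 1) + 1)) * (K * ‖(c n : ℝ) • d n‖) := hn
        _ ≤ ε / (2 * ((K : ℝ) * (‖y‖ + 1) + 1)) * (K * (‖y‖ + 1)) := by gcongr
        _ < ε := by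
            rw [div_mul_eq_mul_div, div_lt_iff₀ (by positivity)]
            nlinarith [mul_nonneg K.coe_nonneg (add_nonneg (norm_nonneg y) zero_le_one)]
    have := hcd'.sub herr
    simpa using this
  -- `im F'` is closed
  have hclosed : IsClosed (range F' : Set V) := by
    have : (range F' : Set V) = (LinearMap.range (F' : P →ₗ[ℝ] V) : Set V) := by
      ext v; simp
    rw [this]
    exact (Submodule.closed_of_finiteDimensional _)
  exact hclosed.mem_of_tendsto hlim (Eventually.of_forall fun n => ⟨_, rfl⟩)

variable [MeasurableSpace V] [BorelSpace V] {m : ℕ}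

/-- **Approximate tangent vectors of an anti-Lipschitz image lie in the image of the differential**:
`Tan^m(μ ⌞ F(E), F u) ⊆ im DF(u)` for every `u ∈ E` and every measure `μ` (the cone of approximate
tangent vectors lies in the tangent cone of the set, `approxTangentCone_restrict_subset_posTangentConeAt`).
[cite: Federer1969, 3.2.16, 3.2.19] -/
theorem approxTangentCone_image_subset_range (μ : Measure V) {F : P → V} {F' : P →L[ℝ] V}
    {E : Set P} {u : P} (hu : u ∈ E) (hF : HasFDerivWithinAt F F' E u) {K : ℝ≥0}
    (hanti : AntilipschitzWith K (E.restrict F)) (hFE : MeasurableSet (F '' E)) :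
    approxTangentCone m (μ.restrict (F '' E)) (F u) ⊆ (range F' : Set V) := by
  refine (approxTangentCone_restrict_subset_posTangentConeAt μ hFE MeasurableSet.univ univ_mem).trans ?_
  rw [inter_univ]
  exact posTangentConeAt_image_subset_range hu hF hanti


/-! ### Almost everywhere, the approximate tangent cone of the image IS the image of the differential -/

section AE

variable {W : Type*} [NormedAddCommGroup W] [NormedSpace ℝ W] [FiniteDimensional ℝ W]
  [MeasurableSpace W] [BorelSpace W] {m : ℕ}

/-- **`Tan^m(𝓗^m ⌞ F(E), F u) = im DF(u)` for `𝓗^m`-almost every point `F u` of a bi-Lipschitz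
piece** `F(E)`, `E ⊆ ℝᵐ` measurable, `F` differentiable relative to `E` with injective
differentials, Lipschitz and anti-Lipschitz on `E`. [cite: Federer1969, 3.2.19] -/
theorem ae_approxTangentCone_image_eq_range {F : EuclideanSpace ℝ (Fin m) → W}
    {F' : EuclideanSpace ℝ (Fin m) → (EuclideanSpace ℝ (Fin m) →L[ℝ] W)}
    {E : Set (EuclideanSpace ℝ (Fin m))} (hF : ∀ u ∈ E, HasFDerivWithinAt F (F' u) E u)
    (hinj : ∀ u ∈ E, Injective (F' u)) {K : ℝ≥0} (hanti : AntilipschitzWith K (E.restrict F))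
    {L : ℝ≥0} (hlip : LipschitzOnWith L F E) (hFE : MeasurableSet (F '' E)) :
    ∀ᵐ y ∂((μHE[m] : Measure W).restrict (F '' E)), ∀ u ∈ E, F u = y →
      approxTangentCone m ((μHE[m] : Measure W).restrict (F '' E)) y = range (F' u) := by
  classical
  set μ' : Measure W := (μHE[m] : Measure W).restrict (F '' E) with hμ'
  -- the normalisation constant `μHE[m] = c • μH[m]`
  set c : ℝ≥0∞ := (addHaarScalarFactor (volume : Measure (EuclideanSpace ℝ (Fin m)))
    (μH[m] : Measure (EuclideanSpace ℝ (Fin m))) : ℝ≥0∞) with hc_def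
  have hc0 : c ≠ 0 := by
    rw [hc_def, Ne, ENNReal.coe_eq_zero]
    exact Measure.addHaarScalarFactor_volume_hausdorffMeasure_ne_zero m
  have hctop : c ≠ ⊤ := ENNReal.coe_ne_top
  have hHE : (μHE[m] : Measure W) = c • (μH[m] : Measure W) := by
    rw [Measure.euclideanHausdorffMeasure_def, hc_def, ENNReal.smul_def]
  have hHE0 : ∀ s : Set W, (μH[m] : Measure W) s = 0 → μ' s = 0 := by
    intro s hs
    rw [hμ']
    refine nonpos_iff_eq_zero.1 ((Measure.le_iff'.1 Measure.restrict_le_self s).trans ?_)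
    rw [hHE, Measure.smul_apply, hs, smul_zero]
  -- Lipschitz extension of `F|_E`, reparametrised by `ℝᵐ = Fin m → ℝ`
  obtain ⟨g₁, hg₁, hg₁E⟩ := hlip.extend_finite_dimension
  let e := EuclideanSpace.equiv (Fin m) ℝ
  set g : (Fin m → ℝ) → W := g₁ ∘ e.symm with hgdef
  have hg : LipschitzWith (lipschitzExtensionConstant W * L * ‖(e.symm : (Fin m → ℝ) →L[ℝ]
      EuclideanSpace ℝ (Fin m))‖₊) g :=
    hg₁.comp (e.symm : (Fin m → ℝ) →L[ℝ] EuclideanSpace ℝ (Fin m)).lipschitz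
  have hgF : ∀ u ∈ E, g (e u) = F u := fun u hu => by
    simp only [hgdef, comp_apply, ContinuousLinearEquiv.symm_apply_apply]
    exact (hg₁E hu).symm
  have hjc : Fintype.card (Fin m) = m := Fintype.card_fin m
  have hvol : (μH[m] : Measure (Fin m → ℝ)) = volume := by
    have := hausdorffMeasure_pi_real (ι := Fin m)
    rwa [hjc] at this
  -- Lebesgue-null exceptional parameter sets
  have h1 : ∀ᵐ u ∂(volume : Measure (Fin m → ℝ)), DifferentiableAt ℝ g u := hg.ae_differentiableAt
  have h2 : ∀ᵐ u ∂(volume : Measure (Fin m → ℝ)), g u ∈ F '' E → DifferentiableAt ℝ g u →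
      Injective (fderiv ℝ g u) → ∀ S : Set W,
        upperDensity m (((μH[m] : Measure W).restrict (F '' E)).restrict Sᶜ) (g u) = 0 →
        ∀ v, fderiv ℝ g u v ∈ posTangentConeAt S (g u) := by
    have := fderiv_apply_mem_posTangentConeAt_ae hg hFE
    rwa [hjc] at this
  set B : Set (Fin m → ℝ) := {u | ¬ (DifferentiableAt ℝ g u ∧
      (g u ∈ F '' E → DifferentiableAt ℝ g u → Injective (fderiv ℝ g u) → ∀ S : Set W,
        upperDensity m (((μH[m] : Measure W).restrict (F '' E)).restrict Sᶜ) (g u) = 0 →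
        ∀ v, fderiv ℝ g u v ∈ posTangentConeAt S (g u)))} with hB
  have hB0 : volume B = 0 := by
    have : ∀ᵐ u ∂(volume : Measure (Fin m → ℝ)), DifferentiableAt ℝ g u ∧
        (g u ∈ F '' E → DifferentiableAt ℝ g u → Injective (fderiv ℝ g u) → ∀ S : Set W,
          upperDensity m (((μH[m] : Measure W).restrict (F '' E)).restrict Sᶜ) (g u) = 0 →
          ∀ v, fderiv ℝ g u v ∈ posTangentConeAt S (g u)) := by
      filter_upwards [h1, h2] with u h1 h2 using ⟨h1, h2⟩
    exact ae_iff.1 this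
  set Z : Set (Fin m → ℝ) := {u | DifferentiableAt ℝ g u ∧ ¬ Injective (fderiv ℝ g u)} with hZ
  have hZ0 : (μH[m] : Measure W) (g '' Z) = 0 := by
    have := Literature.Analysis.Calculus.hausdorffMeasure_image_null_of_fderiv_not_injective hg
    rwa [hjc] at this
  have hB0' : (μH[m] : Measure W) (g '' B) = 0 := by
    refine nonpos_iff_eq_zero.1 ((hg.hausdorffMeasure_image_le (Nat.cast_nonneg m) B).trans ?_)
    rw [hvol, hB0, mul_zero]
  have hbad : ∀ᵐ y ∂μ', y ∉ g '' (B ∪ Z) := by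
    refine measure_eq_zero_iff_ae_notMem.1 (hHE0 _ ?_)
    rw [image_union]
    exact measure_union_null hB0' hZ0
  -- the pointwise argument
  filter_upwards [hbad] with y hy u huE hFu
  have hgu : g (e u) = y := by rw [hgF u huE, hFu]
  have huB : e u ∉ B := fun h => hy ⟨e u, Or.inl h, hgu⟩
  have huZ : e u ∉ Z := fun h => hy ⟨e u, Or.inr h, hgu⟩
  simp only [hB, mem_setOf_eq, not_not] at huB
  obtain ⟨hdiff, hT⟩ := huB
  have hginj : Injective (fderiv ℝ g (e u)) := by
    by_contra h
    exact huZ ⟨hdiff, h⟩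
  set T := fderiv ℝ g (e u) with hT_def
  -- `im Dg ⊆ Tan^m(μ', y)`
  have hTan : ∀ v, T v ∈ approxTangentCone m μ' y := by
    intro v
    rw [← hgu]
    refine mem_iInter₂.2 fun S hS => hT (hgu ▸ ⟨u, huE, hFu⟩) hdiff hginj S ?_ v
    have e1 : μ'.restrict Sᶜ = c • (((μH[m] : Measure W).restrict (F '' E)).restrict Sᶜ) := by
      rw [hμ', hHE, Measure.restrict_smul, Measure.restrict_smul]
    rw [e1, upperDensity_smul _ _ _ hctop, mul_eq_zero] at hS
    exact hS.resolve_left hc0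
  -- `Tan^m(μ', y) ⊆ im F'(u)`
  have hup : approxTangentCone m μ' y ⊆ (range (F' u) : Set W) := by
    rw [← hFu]
    exact approxTangentCone_image_subset_range _ huE (hF u huE) hanti hFE
  -- squeeze between two `m`-planes
  have hle : LinearMap.range (T : (Fin m → ℝ) →ₗ[ℝ] W) ≤ LinearMap.range (F' u : EuclideanSpace ℝ (Fin m) →ₗ[ℝ] W) := by
    rintro _ ⟨v, rfl⟩
    have := hup (hTan v)
    simpa [LinearMap.mem_range] using this
  have heq : LinearMap.range (T : (Fin m → ℝ) →ₗ[ℝ] W) =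
      LinearMap.range (F' u : EuclideanSpace ℝ (Fin m) →ₗ[ℝ] W) := by
    refine Submodule.eq_of_le_of_finrank_le hle ?_
    rw [LinearMap.finrank_range_of_inj hginj, LinearMap.finrank_range_of_inj (hinj u huE),
      finrank_fin_fun, finrank_euclideanSpace_fin]
  refine Subset.antisymm hup ?_
  rintro _ ⟨v, rfl⟩
  have : F' u v ∈ LinearMap.range (T : (Fin m → ℝ) →ₗ[ℝ] W) := by
    rw [heq]; exact ⟨v, rfl⟩
  obtain ⟨w, hw⟩ := this
  rw [← hw]
  exact hTan w

end AE

end Literature.Geometry.GeometricMeasureTheory
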